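import Summits.NavierStokesRegularity.NavierStokesRegularity.Theorems.TerminalTraceTypeITraceScarL3DepthVorticityRigidity
import Summits.NavierStokesRegularity.NavierStokesRegularity.Theorems.TerminalTraceTypeITraceScarL3DepthRigidityTop
import Summits.NavierStokesRegularity.NavierStokesRegularity.Theorems.TerminalTraceTypeITraceScarL3DepthWeakCurl
import Summits.NavierStokesRegularity.NavierStokesRegularity.Theorems.TerminalTraceTypeITraceScarL3StripRepresentative
import Summits.NavierStokesRegularity.NavierStokesRegularity.Theorems.TerminalTraceExtinctApexCompactness
import Literature.Analysis.FluidPDE.LocalTypeIBlowup.Limits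
import HarnessLib

/-!
# Depth vorticity rigidity, part 4 — (Q1) of ROUND-26: a UNIFORM FLOOR for the vorticity at depth of
# singular extinct Type-I apices — helper for item `TerminalTrace.TypeITraceScarL3`
# (stmt-NavierStokesRegularity-18385), stub QA `stub_no_quietShellExtinctApex` of line `annulus-dichotomy`

Seat nsreg-C26-p1 (prover), `--supports stmt-NavierStokesRegularity-18385`; planner of record nsreg-p2
g28, ROUND-26 §1c, step (Q1) «centre concentration at depth» (compactness–rigidity).

* `not_isBackwardSingularPoint_of_weakCurl_ae_zero` — RIGIDITY: a field in Albritton–Barker's class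
  on every `Q(a)` with `𝐈(ℝ³ × ℝ₋) ≤ I` (weak gradient `H`), essentially bounded on every depth strip,
  whose distributional vorticity `curlCLM ∘ H` vanishes a.e. on ONE box `]t₁, t₂[ × B(x₀, r)` at depth
  (`t₂ < 0`) vanishes a.e. on `]t₁, 0[ × ℝ³`; in particular the origin is not backward-singular
  (files `…DepthVorticityRigidity`, `…DepthRigidityTop`).
* `exists_depth_vorticity_floor` — **(Q1), unit scale**: for every class `(M, C)` there is
  `κ₀ > 0` such that every `(U, P, G)` — suitable in every `Q(a)`, weak gradient `G`, `𝐈(Q(a)) ≤ M`,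
  rate `‖U(s)‖ ≤ C/√(−s)` a.e. — which IS backward-singular at the origin has
  `∫∫_{]−1,−½[ × B(0,1)} |curlCLM (G)| ≥ κ₀` (an `L¹` floor for the distributional vorticity at
  depth; the `L²`/enstrophy floor `≥ κ₀²/|box|` follows by Cauchy–Schwarz).  Proof by
  compactness (`local_typeI_compactness_inBall`, with persistence of the singular origin) and
  rigidity: along a violating sequence the weak curls tend to `0` in `L¹` of the box, the curl of
  the limit's weak gradient vanishes there (`weakCurl_ae_zero_of_tendsto`), the rate passes to the
  limit as depth bounds (`ae_norm_le_strip_of_rate`, `ae_norm_le_of_tendsto_eLpNorm`), and the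
  rigidity theorem contradicts the persistence of the singularity.  The hypotheses `hD` (plain
  pressure bound) and `htop` (weak extinction) of the apex package are NOT needed.

WHAT THIS IS NOT: not Stub QA (the quantitative Carleman chain Q2–Q4 of ROUND-26 is not touched),
not item 18385, no statement about Navier–Stokes regularity.
[folklore; AlbrittonBarker2019 §3; SereginSverak2009 Thm 2.8; EscauriazaSereginSverak2003 §3;
KochNadirashviliSereginSverak2009 §4; Tao2021 (arXiv:1908.04958) §5 (5.3)–(5.6) for the role of Q1]
-/

noncomputable section

set_option linter.dupNamespace false

namespace Summit.NavierStokesRegularity.NavierStokesRegularity.Theorems.TypeITraceScarL3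

open MeasureTheory Set Function Filter Topology TopologicalSpace Metric InnerProductSpace
open Literature.Analysis Literature.Analysis.FluidPDE
open scoped NNReal ENNReal RealInnerProductSpace

/-! ### Rigidity: weak curl zero on a box at depth ⇒ the origin is not backward-singular -/

/-- **Depth rigidity (assembled).**  Let `(u, p)` be in Albritton–Barker's class Def. 2.1 on every
`Q(a)`, with a weak gradient `H` on the backward slab and `𝐈(ℝ³ × ℝ₋) ≤ I`, essentially bounded on
every strip `]a', c[ × ℝ³`, `c < 0`.  If `curlCLM (H) = 0` a.e. on a box `]t₁, t₂[ × B(x₀, r)` with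
`t₁ < t₂ < 0`, `r > 0`, then `u = 0` a.e. on `]t₁, 0[ × ℝ³` and the origin is NOT a backward-singular
point of `u`.  (Smooth depth representative `exists_depth_representative`; its classical gradient is
a weak gradient, so it agrees a.e. with `H` (`HasWeakSpatialGradientOn.ae_eq`) and its curl vanishes
on the box; `slab_ae_zero_of_curl_eq_zero_on_ball`; `ae_zero_to_top_of_slab_ae_zero`.)
[folklore; EscauriazaSereginSverak2003 §3; KochNadirashviliSereginSverak2009 §4] -/
theorem not_isBackwardSingularPoint_of_weakCurl_ae_zero
    {u : ℝ → EuclideanSpace ℝ (Fin 3) → EuclideanSpace ℝ (Fin 3)}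
    {p : ℝ → EuclideanSpace ℝ (Fin 3) → ℝ}
    {H : ℝ → EuclideanSpace ℝ (Fin 3) → EuclideanSpace ℝ (Fin 3) →L[ℝ] EuclideanSpace ℝ (Fin 3)}
    (hsw : ∀ a : ℝ, 0 < a →
      IsSuitableWeakSolutionInBall a (0 : ℝ × EuclideanSpace ℝ (Fin 3)) u p)
    (hH : HasWeakSpatialGradientOn (slab (EuclideanSpace ℝ (Fin 3)) (Iio 0) isOpen_Iio) u H)
    {I : ℝ} (hI : typeIBound (Iio (0 : ℝ) ×ˢ (univ : Set (EuclideanSpace ℝ (Fin 3)))) u p H ≤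
      ENNReal.ofReal I)
    (hbd : ∀ a' c : ℝ, c < 0 → ∃ L : ℝ,
      ∀ᵐ z ∂(volume.restrict (Ioo a' c ×ˢ (univ : Set (EuclideanSpace ℝ (Fin 3))))), ‖u z.1 z.2‖ ≤ L)
    {t₁ t₂ : ℝ} {x₀ : EuclideanSpace ℝ (Fin 3)} {r : ℝ} (h12 : t₁ < t₂) (ht₂ : t₂ < 0) (hr : 0 < r)
    (hcurl : ∀ᵐ z ∂(volume.restrict (Ioo t₁ t₂ ×ˢ ball x₀ r)), curlCLM (H z.1 z.2) = 0) :
    (∀ᵐ z ∂(volume.restrict (Ioo t₁ 0 ×ˢ (univ : Set (EuclideanSpace ℝ (Fin 3))))), uncurry u z = 0) ∧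
      ¬ IsBackwardSingularPoint u (0 : ℝ × EuclideanSpace ℝ (Fin 3)) := by
  -- ### the smooth representative on the strip `]t₁ - 1, t₂[ × ℝ³`
  set a : ℝ := t₁ - 1 with ha
  obtain ⟨L, hL⟩ := hbd (a - 1) t₂ ht₂
  obtain ⟨V, hVu, hVc, hCD, hjc, hsol⟩ := exists_depth_representative hsw ht₂.le hL
  have hLs : ∀ᵐ z ∂(volume.restrict (Ioo a t₂ ×ˢ (univ : Set (EuclideanSpace ℝ (Fin 3))))),
      ‖u z.1 z.2‖ ≤ L :=
    ae_restrict_of_ae_restrict_of_subset (prod_mono (Ioo_subset_Ioo_left (by linarith)) Subset.rfl) hL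
  -- ### the box and the two weak gradients of `V` on it
  set O : Set (ℝ × EuclideanSpace ℝ (Fin 3)) := Ioo t₁ t₂ ×ˢ ball x₀ r with hOdef
  have hOo : IsOpen O := isOpen_Ioo.prod isOpen_ball
  have hOstrip : O ⊆ Ioo a t₂ ×ˢ (univ : Set (EuclideanSpace ℝ (Fin 3))) :=
    prod_mono (Ioo_subset_Ioo_left (by rw [ha]; linarith)) (subset_univ _)
  set Oop : Opens (ℝ × EuclideanSpace ℝ (Fin 3)) := ⟨O, hOo⟩ with hOop
  have hfdc : ContinuousOn (fun z : ℝ × EuclideanSpace ℝ (Fin 3) => fderiv ℝ (V z.1) z.2)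
      (Ioo a t₂ ×ˢ (univ : Set (EuclideanSpace ℝ (Fin 3)))) :=
    continuousOn_fderiv_of_continuousOn_iteratedFDeriv_one (hjc 1)
  have hVgrad : HasWeakSpatialGradientOn Oop V (fun t x => fderiv ℝ (V t) x) :=
    hasWeakSpatialGradientOn_of_hasFDerivAt (S := Ioo a t₂) (Q := Oop) hOstrip hVc hfdc
      fun t ht x => ((hCD (t, x) ⟨ht, mem_univ _⟩).differentiableAt (by simp)).hasFDerivAt
  have hHO : HasWeakSpatialGradientOn Oop u H :=
    hH.mono fun z hz => mem_slab.2 (show z.1 ∈ Iio (0 : ℝ) from (hz.1.2.trans ht₂))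
  have hVH : HasWeakSpatialGradientOn Oop V H := by
    refine hHO.congr_ae ?_
    have h1 : uncurry V =ᵐ[volume.restrict O] uncurry u :=
      ae_restrict_of_ae_restrict_of_subset hOstrip hVu
    exact h1.symm
  have hae := HasWeakSpatialGradientOn.ae_eq hVgrad hVH
  -- ### the curl of `V` vanishes on the box
  have hcurlV_ae : ∀ᵐ z ∂(volume.restrict O), curl (V z.1) z.2 = 0 := by
    filter_upwards [hae, hcurl] with z h1 h2
    rw [curl_eq_curlCLM, show fderiv ℝ (V z.1) z.2 = H z.1 z.2 from h1, h2]
  have hcurlV_c : ContinuousOn (fun z : ℝ × EuclideanSpace ℝ (Fin 3) => curl (V z.1) z.2) O :=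
    (curlCLM.continuous.comp_continuousOn (hfdc.mono hOstrip)).congr fun z _ => by
      simp only [comp_apply, curl_eq_curlCLM]
  have hcurlV : ∀ z ∈ O, curl (V z.1) z.2 = 0 := by
    have h := Measure.eqOn_open_of_ae_eq (f := fun z : ℝ × EuclideanSpace ℝ (Fin 3) =>
      curl (V z.1) z.2) (g := fun _ => (0 : EuclideanSpace ℝ (Fin 3))) hcurlV_ae hOo hcurlV_c
      continuousOn_const
    exact fun z hz => h hz
  -- ### rigidity on the slab, then up to the top
  obtain ⟨-, hzero⟩ := slab_ae_zero_of_curl_eq_zero_on_ball hI ht₂.le hLs hsol hVu hVc hCD hjc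
    (t₁ := t₁) (t₂ := t₂) (by rw [ha]; linarith) le_rfl hr hcurlV
  have htop := ae_zero_to_top_of_slab_ae_zero hsw hI hbd h12 ht₂.le hzero
  refine ⟨htop, fun hsing => ?_⟩
  -- ### the origin is not singular
  have ht₁ : t₁ < 0 := h12.trans ht₂
  set r₀ : ℝ := Real.sqrt (-t₁) with hr₀
  have hr₀0 : 0 < r₀ := Real.sqrt_pos.2 (by linarith)
  have hr₀sq : r₀ ^ 2 = -t₁ := Real.sq_sqrt (by linarith)
  have hsub : parabolicCylinder r₀ (0 : ℝ × EuclideanSpace ℝ (Fin 3)) ⊆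
      Ioo t₁ 0 ×ˢ (univ : Set (EuclideanSpace ℝ (Fin 3))) := by
    intro w hw
    rw [mem_parabolicCylinder] at hw
    simp only [Prod.fst_zero, zero_sub] at hw
    exact ⟨⟨by linarith [hw.1.1], hw.1.2⟩, mem_univ _⟩
  have h0 : uncurry u =ᵐ[volume.restrict (parabolicCylinder r₀ (0 : ℝ × EuclideanSpace ℝ (Fin 3)))]
      (0 : ℝ × EuclideanSpace ℝ (Fin 3) → EuclideanSpace ℝ (Fin 3)) :=
    ae_restrict_of_ae_restrict_of_subset hsub htop
  have h := hsing r₀ hr₀0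
  rw [eLpNorm_congr_ae h0, eLpNorm_zero] at h
  exact ENNReal.zero_ne_top h

/-! ### (Q1): the uniform vorticity floor at depth, unit scale -/

/-- **(Q1) — uniform floor for the vorticity at depth of singular extinct Type-I apices, unit
scale.**  For every class `(M, C)` there is `κ₀ > 0` such that: if `(U, P)` is a suitable weak
solution in every `Q(a)` about the origin with weak gradient `G`, `𝐈(Q(a)) ≤ M` for all `a`, rate
`‖U(s, ·)‖ ≤ C/√(−s)` a.e. for every `s < 0`, and the origin IS a backward-singular point, then the
distributional vorticity has `∫∫_{]−1,−½[ × B(0,1)} |curlCLM (G)| ≥ κ₀`.  Compactness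
(`local_typeI_compactness_inBall` + persistence of singularities) and rigidity
(`not_isBackwardSingularPoint_of_weakCurl_ae_zero`), the weak curl passing to the limit by
`weakCurl_ae_zero_of_tendsto`.  (ROUND-26 §1c (Q1); cf. Tao 2021 (5.3)–(5.6), Barker–Prange 2021
Remark 5 for the `L^{3,∞}` analogue in print.) [folklore; AlbrittonBarker2019 §3; SereginSverak2009
Thm 2.8; EscauriazaSereginSverak2003 §3] -/
theorem exists_depth_vorticity_floor (M : ℝ≥0) (C : ℝ) :
    ∃ κ₀ : ℝ, 0 < κ₀ ∧
    ∀ (U : ℝ → EuclideanSpace ℝ (Fin 3) → EuclideanSpace ℝ (Fin 3))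
      (P : ℝ → EuclideanSpace ℝ (Fin 3) → ℝ)
      (G : ℝ → EuclideanSpace ℝ (Fin 3) → EuclideanSpace ℝ (Fin 3) →L[ℝ] EuclideanSpace ℝ (Fin 3)),
      (∀ a : ℝ, 0 < a →
        IsSuitableWeakSolutionInBall a (0 : ℝ × EuclideanSpace ℝ (Fin 3)) U P) →
      (∀ a : ℝ, 0 < a →
        HasWeakSpatialGradientOn
          (parabolicCylinderOpens a (0 : ℝ × EuclideanSpace ℝ (Fin 3))) U G) →
      (∀ a : ℝ, 0 < a →
        typeIBound (parabolicCylinder a (0 : ℝ × EuclideanSpace ℝ (Fin 3))) U P G ≤ M) →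
      (∀ s : ℝ, s < 0 →
        ∀ᵐ y : EuclideanSpace ℝ (Fin 3), ‖U s y‖ ≤ C / Real.sqrt (-s)) →
      IsBackwardSingularPoint U (0 : ℝ × EuclideanSpace ℝ (Fin 3)) →
      ENNReal.ofReal κ₀ ≤
        ∫⁻ z in Ioo (-1 : ℝ) (-1 / 2) ×ˢ ball (0 : EuclideanSpace ℝ (Fin 3)) 1,
          ‖curlCLM (G z.1 z.2)‖ₑ := by
  by_contra hcon
  push Not at hcon
  -- ### a violating sequence
  have hseq : ∀ k : ℕ, ∃ (U : ℝ → EuclideanSpace ℝ (Fin 3) → EuclideanSpace ℝ (Fin 3))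
      (P : ℝ → EuclideanSpace ℝ (Fin 3) → ℝ)
      (G : ℝ → EuclideanSpace ℝ (Fin 3) → EuclideanSpace ℝ (Fin 3) →L[ℝ] EuclideanSpace ℝ (Fin 3)),
      (∀ a : ℝ, 0 < a →
        IsSuitableWeakSolutionInBall a (0 : ℝ × EuclideanSpace ℝ (Fin 3)) U P) ∧
      (∀ a : ℝ, 0 < a →
        HasWeakSpatialGradientOn
          (parabolicCylinderOpens a (0 : ℝ × EuclideanSpace ℝ (Fin 3))) U G) ∧
      (∀ a : ℝ, 0 < a →
        typeIBound (parabolicCylinder a (0 : ℝ × EuclideanSpace ℝ (Fin 3))) U P G ≤ M) ∧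
      (∀ s : ℝ, s < 0 →
        ∀ᵐ y : EuclideanSpace ℝ (Fin 3), ‖U s y‖ ≤ C / Real.sqrt (-s)) ∧
      IsBackwardSingularPoint U (0 : ℝ × EuclideanSpace ℝ (Fin 3)) ∧
      ∫⁻ z in Ioo (-1 : ℝ) (-1 / 2) ×ˢ ball (0 : EuclideanSpace ℝ (Fin 3)) 1,
          ‖curlCLM (G z.1 z.2)‖ₑ < ENNReal.ofReal (1 / ((k : ℝ) + 1)) := by
    intro k
    obtain ⟨U, P, G, h1, h2, h3, h4, h5, h6⟩ := hcon (1 / ((k : ℝ) + 1)) (by positivity)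
    exact ⟨U, P, G, h1, h2, h3, h4, h5, h6⟩
  choose U P G hsw hG hI hrate hsing hsmall using hseq
  -- ### compactness with persistence of the singular origin
  have hpow : ∀ m : ℕ, (0 : ℝ) < (2 : ℝ) ^ m := fun m => by positivity
  obtain ⟨u, p, H, σ, hσ, -, hHu, h4I, hballs, hmem, hconv, hpers⟩ :=
    TerminalTraceExtinctApexCompactness.local_typeI_compactness_inBall (M : ℝ≥0∞) U P G
      ENNReal.coe_lt_top (fun m k _ => hsw k _ (hpow m)) (fun m k _ => hG k _ (hpow m))
      (fun m k _ => hI k _ (hpow m))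
  have hsingu : IsBackwardSingularPoint u 0 := by
    refine hpers fun R hR => ?_
    have h : (fun j => eLpNorm (uncurry (U (σ j))) ⊤
        (volume.restrict (parabolicCylinder R (0 : ℝ × EuclideanSpace ℝ (Fin 3))))) =
        fun _ => (⊤ : ℝ≥0∞) := funext fun j => hsing (σ j) R hR
    rw [h, limsup_const]
  -- ### depth bounds of the limit from the rate
  have hbd : ∀ a' c : ℝ, c < 0 → ∃ L : ℝ,
      ∀ᵐ z ∂(volume.restrict (Ioo a' c ×ˢ (univ : Set (EuclideanSpace ℝ (Fin 3))))),
        ‖u z.1 z.2‖ ≤ L := by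
    intro a' c hc
    refine ⟨|C| / Real.sqrt (-c), ?_⟩
    have hcov : Ioo a' c ×ˢ (univ : Set (EuclideanSpace ℝ (Fin 3))) ⊆
        ⋃ n : ℕ, (Ioo a' c ×ˢ (univ : Set (EuclideanSpace ℝ (Fin 3)))) ∩
          parabolicCylinder ((n : ℝ) + 1) (0 : ℝ × EuclideanSpace ℝ (Fin 3)) := by
      rintro ⟨s, y⟩ ⟨hs, -⟩
      obtain ⟨n, hn⟩ := exists_nat_ge (‖y‖ - s)
      refine mem_iUnion.2 ⟨n, ⟨hs, mem_univ _⟩, ?_⟩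
      rw [mem_parabolicCylinder]
      simp only [Prod.fst_zero, Prod.snd_zero, zero_sub, dist_zero_right]
      have hs0 : s < 0 := hs.2.trans hc
      have hy : 0 ≤ ‖y‖ := norm_nonneg y
      refine ⟨⟨?_, hs0⟩, by linarith⟩
      nlinarith
    refine ae_restrict_of_ae_restrict_of_subset hcov ?_
    rw [ae_restrict_iUnion_iff]
    intro n
    set Sn : Set (ℝ × EuclideanSpace ℝ (Fin 3)) := (Ioo a' c ×ˢ (univ : Set (EuclideanSpace ℝ (Fin 3)))) ∩
      parabolicCylinder ((n : ℝ) + 1) (0 : ℝ × EuclideanSpace ℝ (Fin 3)) with hSn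
    have hnpos : (0 : ℝ) < (n : ℝ) + 1 := by positivity
    have hSQ : Sn ⊆ parabolicCylinder ((n : ℝ) + 1) (0 : ℝ × EuclideanSpace ℝ (Fin 3)) :=
      inter_subset_right
    have hvm : ∀ j, AEStronglyMeasurable (uncurry (U (σ j))) (volume.restrict Sn) := fun j =>
      (hsw (σ j) _ hnpos).1.distributional.1.aestronglyMeasurable.mono_measure
        (Measure.restrict_mono hSQ le_rfl)
    have hum : AEStronglyMeasurable (uncurry u) (volume.restrict Sn) :=
      (hmem _ hnpos).1.mono_measure (Measure.restrict_mono hSQ le_rfl)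
    have hconvn : Tendsto (fun j => eLpNorm (uncurry (U (σ j)) - uncurry u) 3 (volume.restrict Sn))
        atTop (𝓝 0) :=
      tendsto_of_tendsto_of_tendsto_of_le_of_le tendsto_const_nhds (hconv _ hnpos)
        (fun _ => bot_le) fun j => eLpNorm_mono_measure _ (Measure.restrict_mono hSQ le_rfl)
    have hbdj : ∀ j, ∀ᵐ w ∂(volume.restrict Sn), ‖uncurry (U (σ j)) w‖ ≤ |C| / Real.sqrt (-c) :=
      fun j => ae_restrict_of_ae_restrict_of_subset inter_subset_left
        (ae_norm_le_strip_of_rate (hsw (σ j)) (hrate (σ j)) hc)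
    exact LocalTypeIBlowup.ae_norm_le_of_tendsto_eLpNorm hvm hum hconvn hbdj
  -- ### the weak curl of the limit vanishes on the box
  set O : Set (ℝ × EuclideanSpace ℝ (Fin 3)) :=
    Ioo (-1 : ℝ) (-1 / 2) ×ˢ ball (0 : EuclideanSpace ℝ (Fin 3)) 1 with hOdef
  have hOo : IsOpen O := isOpen_Ioo.prod isOpen_ball
  have hOQ : O ⊆ parabolicCylinder 2 (0 : ℝ × EuclideanSpace ℝ (Fin 3)) := by
    rintro ⟨s, y⟩ ⟨hs, hy⟩
    rw [mem_parabolicCylinder]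
    simp only [Prod.fst_zero, Prod.snd_zero, zero_sub, dist_zero_right]
    rw [mem_ball_zero_iff] at hy
    exact ⟨⟨by linarith [hs.1], by linarith [hs.2]⟩, by linarith⟩
  have hGO : ∀ j, HasWeakSpatialGradientOn ⟨O, hOo⟩ (U (σ j)) (G (σ j)) := fun j =>
    (hG (σ j) 2 two_pos).mono fun z hz => hOQ hz
  have hHO : HasWeakSpatialGradientOn ⟨O, hOo⟩ u H :=
    hHu.mono fun z hz => mem_slab.2 (show z.1 ∈ Iio (0 : ℝ) from hz.1.2.trans (by norm_num))
  have hsmallσ : Tendsto (fun j => ∫⁻ z in O, ‖curlCLM (G (σ j) z.1 z.2)‖ₑ) atTop (𝓝 0) := by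
    have hlim : Tendsto (fun j => ENNReal.ofReal (1 / ((σ j : ℝ) + 1))) atTop (𝓝 0) := by
      rw [← ENNReal.ofReal_zero]
      refine ENNReal.tendsto_ofReal ?_
      have h1 : Tendsto (fun j => ((σ j : ℝ) + 1)) atTop atTop := by
        refine tendsto_atTop_add_const_right _ 1 ?_
        exact tendsto_natCast_atTop_atTop.comp hσ.tendsto_atTop
      exact tendsto_const_nhds.div_atTop h1
    exact tendsto_of_tendsto_of_tendsto_of_le_of_le tendsto_const_nhds hlim (fun _ => bot_le)
      fun j => (hsmall (σ j)).le
  have hcurl0 := weakCurl_ae_zero_of_tendsto hOo hOQ hGO hHO (hconv 2 two_pos) hsmallσ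
  -- ### rigidity contradicts the persistence of the singularity
  have h4I' : typeIBound (Iio (0 : ℝ) ×ˢ (univ : Set (EuclideanSpace ℝ (Fin 3)))) u p H ≤
      ENNReal.ofReal (4 * M) := by
    rw [ENNReal.ofReal_mul (by norm_num), ENNReal.ofReal_coe_nnreal,
      show ENNReal.ofReal (4 : ℝ) = 4 by norm_num]
    exact h4I
  exact (not_isBackwardSingularPoint_of_weakCurl_ae_zero hballs hHu h4I' hbd
    (by norm_num : (-1 : ℝ) < -1 / 2) (by norm_num) one_pos hcurl0).2 hsingu

end Summit.NavierStokesRegularity.NavierStokesRegularity.Theorems.TypeITraceScarL3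

end
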